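import Mathlib
import Literature.Analysis.FluidPDE.EnstrophySplittingDissipation
import Literature.Analysis.FluidPDE.NormalisedPressure
import Summits.NavierStokesRegularity.NavierStokesRegularity.Theorems.LevelSetModerationLevelSetEnergyInequalityViscous
import Summits.NavierStokesRegularity.NavierStokesRegularity.Theorems.LevelSetModerationLevelSetEnergyInequalityBalance

/-!
# Route LevelSetModeration — `LevelSetEnergyInequality`: slice bookkeeping (helper file 5)

Support lemmas for item stmt-NavierStokesRegularity-18151 (Vasseur 2007, Lemma 11 globalised for
the speed of a classical Navier–Stokes solution on `ℝ³`), at a fixed time, with the truncation weight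
`k₀(u) = (|u|-c)₊ / max(|u|,c)`:

* `slice_identity` — dotting the momentum equation `∂ₜu + (u·∇)u = νΔu - ∇q` with `k₀(u) u` and
  integrating: `∫ k₀⟪∂ₜu, u⟫ = ν∫ k₀⟪Δu, u⟫ - ∫ k₀⟪∇q, u⟫` (the transport term vanishes,
  `transport_slice`);
* `lintegral_levelSet_fderiv_norm_le` — the printed level-set dissipation
  `∫ 1_{|u|>c} ‖D|u|‖²` is at most `∫ 1_{|u|>c} Σᵢ⟪u, ∂ᵢu⟫²/max(|u|,c)²` (`‖D|u|‖² ≤ Σᵢ⟪u,∂ᵢu⟫²/|u|²`);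
* `integral_weight_pressure_eq` — for a pressure of the form `q = p̃[u] + C` the pressure work
  `∫ k₀⟪∇q, u⟫` is the printed `∫ (1 - c/|u|)₊ Dp̃[u](u)`;
* `lintegral_enorm_sq_le_of_norm_le_mul` — `L²` bookkeeping.

## References
* A. F. Vasseur, NoDEA 14 (2007), Lemma 11 and its proof. [Vasseur2007]
* T. Tao, Anal. PDE 6 (2013), Lemma 4.1 (i) (normalised pressure). [Tao2011]
-/

noncomputable section

-- single-conjunct summit: `Summit.<Summit>.<Problem>` repeats the name by the D-0017 layout
set_option linter.dupNamespace false

namespace Summit.NavierStokesRegularity.NavierStokesRegularity.Theorems.LevelSetEnergyInequality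

open Real Set Filter Topology MeasureTheory InnerProductSpace Function
open scoped RealInnerProductSpace ENNReal NNReal Laplacian
open Literature.Analysis.FluidPDE

/-- `‖a‖ ≤ K ‖b‖` pointwise gives `∫ ‖a‖ₑ² ≤ K² ∫ ‖b‖ₑ²`. -/
theorem lintegral_enorm_sq_le_of_norm_le_mul {α : Type*} [MeasurableSpace α] {μ : Measure α}
    {G₁ G₂ : Type*} [NormedAddCommGroup G₁] [NormedAddCommGroup G₂] {a : α → G₁} {b : α → G₂}
    (K : ℝ≥0) (h : ∀ x, ‖a x‖ ≤ K * ‖b x‖) :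
    ∫⁻ x, ‖a x‖ₑ ^ 2 ∂μ ≤ (K : ℝ≥0∞) ^ 2 * ∫⁻ x, ‖b x‖ₑ ^ 2 ∂μ := by
  have hpt : ∀ x, ‖a x‖ₑ ^ 2 ≤ (K : ℝ≥0∞) ^ 2 * ‖b x‖ₑ ^ 2 := fun x => by
    have h1 : ‖a x‖ₑ ≤ (K : ℝ≥0∞) * ‖b x‖ₑ := by
      rw [← ofReal_norm, ← ofReal_norm (b x), ← ENNReal.ofReal_coe_nnreal,
        ← ENNReal.ofReal_mul K.coe_nonneg]
      exact ENNReal.ofReal_le_ofReal (h x)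
    calc ‖a x‖ₑ ^ 2 ≤ ((K : ℝ≥0∞) * ‖b x‖ₑ) ^ 2 := pow_le_pow_left' h1 2
      _ = (K : ℝ≥0∞) ^ 2 * ‖b x‖ₑ ^ 2 := mul_pow _ _ _
  calc ∫⁻ x, ‖a x‖ₑ ^ 2 ∂μ ≤ ∫⁻ x, (K : ℝ≥0∞) ^ 2 * ‖b x‖ₑ ^ 2 ∂μ := lintegral_mono hpt
    _ = (K : ℝ≥0∞) ^ 2 * ∫⁻ x, ‖b x‖ₑ ^ 2 ∂μ :=
        lintegral_const_mul' _ _ (ENNReal.pow_ne_top ENNReal.coe_ne_top)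

/-- `‖∇q(x)‖ = ‖D¹q(x)‖`. -/
theorem norm_gradient_eq_norm_iteratedFDeriv_one (q : EuclideanSpace ℝ (Fin 3) → ℝ)
    (x : EuclideanSpace ℝ (Fin 3)) : ‖gradient q x‖ = ‖iteratedFDeriv ℝ 1 q x‖ := by
  rw [gradient, LinearIsometryEquiv.norm_map, ← norm_iteratedFDeriv_fderiv, norm_iteratedFDeriv_zero]

/-- **The slice identity** (Vasseur 2007, proof of Lemma 11: the momentum equation dotted with
`(1 - c/|u|)₊ u` and integrated over space; the transport term integrates to zero). For a `C²`
divergence-free bounded field `v` with `v, Dv, D²v ∈ L²`, a `C¹` scalar `q` with `Dq ∈ L²`, and a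
field `W` with the momentum equation `W + Dv(v) = νΔv - ∇q`:
`∫ k₀(v)⟪W, v⟫ = ν ∫ k₀(v)⟪Δv, v⟫ - ∫ k₀(v)⟪∇q, v⟫`. -/
theorem slice_identity {c ν B : ℝ} (hc : 0 < c)
    {v W : EuclideanSpace ℝ (Fin 3) → EuclideanSpace ℝ (Fin 3)} {q : EuclideanSpace ℝ (Fin 3) → ℝ}
    (hv : ContDiff ℝ 2 v) (hq : ContDiff ℝ 1 q)
    (hmom : ∀ x, W x + fderiv ℝ v x (v x) = ν • (Δ v) x - gradient q x)
    (hdiv : VectorCalculus.IsDivFree v) (hB : ∀ x, ‖v x‖ ≤ B)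
    (h0 : ∫⁻ x, ‖v x‖ₑ ^ 2 < ⊤) (h1 : ∫⁻ x, ‖iteratedFDeriv ℝ 1 v x‖ₑ ^ 2 < ⊤)
    (h2 : ∫⁻ x, ‖iteratedFDeriv ℝ 2 v x‖ₑ ^ 2 < ⊤) (hq1 : ∫⁻ x, ‖iteratedFDeriv ℝ 1 q x‖ₑ ^ 2 < ⊤) :
    ∫ x, max (‖v x‖ - c) 0 / max ‖v x‖ c * ⟪W x, v x⟫ =
      ν * (∫ x, max (‖v x‖ - c) 0 / max ‖v x‖ c * ⟪(Δ v) x, v x⟫) -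
        ∫ x, max (‖v x‖ - c) 0 / max ‖v x‖ c * ⟪gradient q x, v x⟫ := by
  have hB0 : 0 ≤ B := (norm_nonneg _).trans (hB 0)
  have hv1 : ContDiff ℝ 1 v := hv.of_le one_le_two
  have cv : Continuous v := hv.continuous
  have cDv : Continuous (fderiv ℝ v) := hv.continuous_fderiv (by norm_num)
  have cΔ : Continuous (Δ v) := continuous_laplacian hv
  have cgq : Continuous (gradient q) := continuous_gradient_of_contDiff hq
  have ck : Continuous fun x => max (‖v x‖ - c) 0 / max ‖v x‖ c := (continuous_weight hc).comp cv
  have hk01 : ∀ x, 0 ≤ max (‖v x‖ - c) 0 / max ‖v x‖ c ∧ max (‖v x‖ - c) 0 / max ‖v x‖ c ≤ 1 :=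
    fun x => ⟨weight_nonneg hc _, weight_le_one hc _⟩
  have habsk : ∀ x, |max (‖v x‖ - c) 0 / max ‖v x‖ c| ≤ 1 := fun x => by
    rw [abs_of_nonneg (hk01 x).1]; exact (hk01 x).2
  -- `L²` facts
  have l2Δ : ∫⁻ x, ‖(Δ v) x‖ₑ ^ 2 < ⊤ := by
    have h3 : ∫⁻ x, ‖(3 : ℝ) • iteratedFDeriv ℝ 2 v x‖ₑ ^ 2 < ⊤ :=
      lintegral_enorm_sq_const_smul_lt_top 3 h2
    refine lintegral_enorm_sq_lt_top_of_norm_le (fun x => ?_) h3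
    rw [norm_smul, Real.norm_of_nonneg (by norm_num : (0 : ℝ) ≤ 3)]
    exact norm_laplacian_le_three_mul_norm_iteratedFDeriv_two hv x
  have l2gq : ∫⁻ x, ‖gradient q x‖ₑ ^ 2 < ⊤ :=
    lintegral_enorm_sq_lt_top_of_norm_le (fun x => (norm_gradient_eq_norm_iteratedFDeriv_one q x).le) hq1
  have l2Dv : ∫⁻ x, ‖fderiv ℝ v x‖ₑ ^ 2 < ⊤ :=
    lintegral_enorm_sq_lt_top_of_norm_le (fun x => by
      rw [← norm_iteratedFDeriv_fderiv, norm_iteratedFDeriv_zero]) h1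
  have l2nDv : ∫⁻ x, ‖(‖fderiv ℝ v x‖)‖ₑ ^ 2 < ⊤ :=
    lintegral_enorm_sq_lt_top_of_norm_le (fun x => by rw [norm_norm]) l2Dv
  have l2BDv : ∫⁻ x, ‖B * ‖fderiv ℝ v x‖‖ₑ ^ 2 < ⊤ := by
    have h := lintegral_enorm_sq_const_smul_lt_top B l2nDv
    simpa only [smul_eq_mul] using h
  -- integrability of the three paired terms
  have iA : Integrable (fun x => max (‖v x‖ - c) 0 / max ‖v x‖ c * ⟪(Δ v) x, v x⟫) volume :=
    integrable_of_norm_le_mul_of_lintegral_sq (ck.mul (cΔ.inner cv)).aestronglyMeasurable cΔ cv l2Δ h0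
      fun x => by
        rw [norm_mul, Real.norm_eq_abs]
        exact (mul_le_of_le_one_left (norm_nonneg _) (habsk x)).trans (norm_inner_le_norm _ _)
  have iP : Integrable (fun x => max (‖v x‖ - c) 0 / max ‖v x‖ c * ⟪gradient q x, v x⟫) volume :=
    integrable_of_norm_le_mul_of_lintegral_sq (ck.mul (cgq.inner cv)).aestronglyMeasurable cgq cv l2gq
      h0 fun x => by
        rw [norm_mul, Real.norm_eq_abs]
        exact (mul_le_of_le_one_left (norm_nonneg _) (habsk x)).trans (norm_inner_le_norm _ _)
  have cT : Continuous fun x => max (‖v x‖ - c) 0 / max ‖v x‖ c * ⟪fderiv ℝ v x (v x), v x⟫ :=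
    ck.mul ((cDv.clm_apply cv).inner cv)
  have cBDv : Continuous fun x => B * ‖fderiv ℝ v x‖ := continuous_const.mul cDv.norm
  have iT : Integrable (fun x => max (‖v x‖ - c) 0 / max ‖v x‖ c * ⟪fderiv ℝ v x (v x), v x⟫)
      volume := by
    refine integrable_of_norm_le_mul_of_lintegral_sq (b := fun x => B * ‖fderiv ℝ v x‖)
      cT.aestronglyMeasurable cv cBDv h0 l2BDv fun x => ?_
    rw [norm_mul, Real.norm_eq_abs, Real.norm_of_nonneg (by positivity : (0 : ℝ) ≤ B * ‖fderiv ℝ v x‖)]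
    calc |max (‖v x‖ - c) 0 / max ‖v x‖ c| * ‖⟪fderiv ℝ v x (v x), v x⟫‖
        ≤ 1 * (‖fderiv ℝ v x (v x)‖ * ‖v x‖) := by
          gcongr
          · exact habsk x
          · exact norm_inner_le_norm _ _
      _ ≤ 1 * (‖fderiv ℝ v x‖ * ‖v x‖ * ‖v x‖) := by
          gcongr
          exact ContinuousLinearMap.le_opNorm _ _
      _ ≤ 1 * (‖fderiv ℝ v x‖ * B * ‖v x‖) := by gcongr; exact hB x
      _ = ‖v x‖ * (B * ‖fderiv ℝ v x‖) := by ring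
  -- the transport term vanishes
  have hT : ∫ x, max (‖v x‖ - c) 0 / max ‖v x‖ c * ⟪fderiv ℝ v x (v x), v x⟫ = 0 :=
    transport_slice hc hv1 hdiv hB h0 h1
  -- pointwise: the momentum equation dotted with `k₀ v`
  have hpt : ∀ x, max (‖v x‖ - c) 0 / max ‖v x‖ c * ⟪W x, v x⟫ =
      ν * (max (‖v x‖ - c) 0 / max ‖v x‖ c * ⟪(Δ v) x, v x⟫) -
        max (‖v x‖ - c) 0 / max ‖v x‖ c * ⟪gradient q x, v x⟫ -
        max (‖v x‖ - c) 0 / max ‖v x‖ c * ⟪fderiv ℝ v x (v x), v x⟫ := by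
    intro x
    have hWx : W x = ν • (Δ v) x - gradient q x - fderiv ℝ v x (v x) := eq_sub_of_add_eq (hmom x)
    rw [hWx, inner_sub_left, inner_sub_left, real_inner_smul_left]
    ring
  have iνA : Integrable (fun x => ν * (max (‖v x‖ - c) 0 / max ‖v x‖ c * ⟪(Δ v) x, v x⟫)) volume :=
    iA.const_mul ν
  have iAP : Integrable (fun x => ν * (max (‖v x‖ - c) 0 / max ‖v x‖ c * ⟪(Δ v) x, v x⟫) -
      max (‖v x‖ - c) 0 / max ‖v x‖ c * ⟪gradient q x, v x⟫) volume := iνA.sub iP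
  rw [integral_congr_ae (Eventually.of_forall hpt), integral_sub iAP iT, integral_sub iνA iP,
    integral_const_mul, hT, sub_zero]

/-- **The printed level-set dissipation is dominated by the level gradient density** (Vasseur
2007, Lemma 11, "`|∇|u|| ≤ |∇u|`" step): for `v ∈ C¹(ℝ³)` with `Dv ∈ L²` and `c > 0`,
`∫ 1_{|v|>c} ‖D|v|‖² ≤ ∫ 1_{|v|>c} Σᵢ⟪v, ∂ᵢv⟫² / max(|v|,c)²` (as `ℝ≥0∞` quantities; on the level set
`max(|v|,c) = |v|` and `‖D|v|(x)‖² ≤ Σᵢ⟪v,∂ᵢv⟫²/|v|²`). -/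
theorem lintegral_levelSet_fderiv_norm_le {c : ℝ} (hc : 0 < c)
    {v : EuclideanSpace ℝ (Fin 3) → EuclideanSpace ℝ (Fin 3)} (hv : ContDiff ℝ 1 v)
    (h1 : ∫⁻ x, ‖iteratedFDeriv ℝ 1 v x‖ₑ ^ 2 < ⊤) :
    ∫⁻ x, Set.indicator {x | c < ‖v x‖}
        (fun x => ENNReal.ofReal (‖fderiv ℝ (fun y => ‖v y‖) x‖ ^ 2)) x ≤
      ENNReal.ofReal (∫ x, Set.indicator {x | c < ‖v x‖}
        (fun x => (∑ i, ⟪v x, fderiv ℝ v x (EuclideanSpace.basisFun (Fin 3) ℝ i)⟫ ^ 2) /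
          max ‖v x‖ c ^ 2) x) := by
  obtain ⟨-, hG0, iG⟩ := integrable_levelGradSq hc hv h1
  have hS : MeasurableSet {x | c < ‖v x‖} :=
    (isOpen_lt continuous_const (continuous_norm.comp hv.continuous)).measurableSet
  have iGS := iG.indicator hS
  have hnn : 0 ≤ᵐ[volume] fun x => Set.indicator {x | c < ‖v x‖}
      (fun x => (∑ i, ⟪v x, fderiv ℝ v x (EuclideanSpace.basisFun (Fin 3) ℝ i)⟫ ^ 2) /
        max ‖v x‖ c ^ 2) x :=
    Eventually.of_forall fun x => Set.indicator_nonneg (fun y _ => hG0 y) x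
  rw [ofReal_integral_eq_lintegral_ofReal iGS hnn]
  refine lintegral_mono fun x => ?_
  by_cases hx : c < ‖v x‖
  · rw [Set.indicator_of_mem (show x ∈ {x | c < ‖v x‖} from hx),
      Set.indicator_of_mem (show x ∈ {x | c < ‖v x‖} from hx), max_eq_left hx.le]
    refine ENNReal.ofReal_le_ofReal ?_
    have hvx : v x ≠ 0 := by
      intro h0; rw [h0, norm_zero] at hx; exact absurd hx (not_lt.2 hc.le)
    exact norm_fderiv_norm_sq_le (hv.differentiable one_ne_zero x) hvx
  · rw [Set.indicator_of_notMem (show x ∉ {x | c < ‖v x‖} from hx),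
      Set.indicator_of_notMem (show x ∉ {x | c < ‖v x‖} from hx), ENNReal.ofReal_zero]

/-- **The pressure work in printed form.** If `q = p̃[v] + C` (Tao's normalisation), then
`∫ k₀(v)⟪∇q, v⟫ = ∫ (1 - c/|v|)₊ Dp̃[v](x)(v)` (`∇q = ∇p̃[v]`, and the two weights differ only at
`v = 0`, where the integrand vanishes). -/
theorem integral_weight_pressure_eq {c : ℝ} (hc : 0 < c)
    {v : EuclideanSpace ℝ (Fin 3) → EuclideanSpace ℝ (Fin 3)} {q : EuclideanSpace ℝ (Fin 3) → ℝ}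
    {C : ℝ} (hq : ∀ x, q x = normalisedPressure v x + C) :
    ∫ x, max (‖v x‖ - c) 0 / max ‖v x‖ c * ⟪gradient q x, v x⟫ =
      ∫ x, max (1 - c / ‖v x‖) 0 * (fderiv ℝ (normalisedPressure v) x (v x)) := by
  have hfun : normalisedPressure v = fun x => q x - C := funext fun x => by rw [hq x]; ring
  refine integral_congr_ae (Eventually.of_forall fun x => ?_)
  have hD : fderiv ℝ (normalisedPressure v) x = fderiv ℝ q x := by
    rw [hfun, fderiv_sub_const]
  show max (‖v x‖ - c) 0 / max ‖v x‖ c * ⟪gradient q x, v x⟫ =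
    max (1 - c / ‖v x‖) 0 * (fderiv ℝ (normalisedPressure v) x (v x))
  rw [hD, gradient, InnerProductSpace.toDual_symm_apply]
  exact weight_mul_eq_posPart_mul hc (v x) fun h0 => by rw [h0, map_zero]

end Summit.NavierStokesRegularity.NavierStokesRegularity.Theorems.LevelSetEnergyInequality

end
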